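import Summits.CriticalPhenomena.PercolationContinuityZ3.Theorems.PercNearOneGluingNoHeavyLowerTailQ44SingleSourceK2K4s

/-!
# The K1/c-lobe residual of the single-source packing has odd targets in every graph fibre

Support file for crux `stmt-CriticalPhenomena-4575` (master-family programme, row `Q44`, single-source packing), seat
`prim-bnk-1` gen 27; memo `run/shared/lean/prim/prim-l12/FROM-prim-bnk-1-gen27-SINGLE-SOURCE-ANATOMY.md` §5d.

THEOREM (`exists_odd_good_K1cLobe`).  In a graph fibre on `Fin n` (base edges `C`, free edges `M`, marked points
`a b c y`, cell labelling `ι` with `prof a b c y (C ∪ T) = pp (ι T)`), let `𝒮` be a nonempty family of subsets of `M`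
each of which is a `K1[ab|cy]`-side (cells `(ab|cy ; ac|by)` = `(11, 9)` for `(T, M ∖ T)`) or an `a→c` lobe
(cells `(ac|b|y ; a|bcy)` = `(5, 7)`).  Then some (fat) good of the cell map `κ T = ι (T ∩ M)` contains an odd number of
members of `𝒮`.  This is the residual shape (U1) of the single-source packing (memo §3, §5e: mixed-lobe configurations),
settled by the same handshake kernel as `…Q44SingleSourceK2K4s` (memo §5d) with the maximal `K1[ab|cy]`-side as base:
its `ab`-component kernels have cells `(ab|c|y ; abcy)`, compatible with both member types; `a→c` lobes never join `a–b`,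
so they neither contain the base nor its `ab`-component.  No sorries, no definitions, standard axioms.
-/

namespace Summit.CriticalPhenomena.PercolationContinuityZ3.Theorems

namespace TwoCopyMono

open Finset FourPointAtoms KernelPeeling Literature.Probability.Percolation

variable {n : ℕ}

/-! ## Cell bookkeeping -/

/-- Table fact: a cell above `ac|by` joining `c–y` is `abcy`. [this work] -/
theorem cell_eq_fourteen_of_acby (i : Fin 15) (h1 : ple 9 i = true) (h2 : pp i 2 3 = true) : i = 14 := by
  revert i; decide

/-! ## The theorem -/

/-- **Odd targets for K1[ab|cy] / a→c-lobe families (memo §5e).**  See the module docstring. [this work] -/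
theorem exists_odd_good_K1cLobe (a b c y : Fin n) (C M : Finset (Sym2 (Fin n)))
    (ι : Finset (Sym2 (Fin n)) → Fin 15) (hι : ∀ T : Finset (Sym2 (Fin n)), prof a b c y ↑(C ∪ T) = pp (ι T))
    (𝒮 : Finset (Finset (Sym2 (Fin n)))) (hne : 𝒮.Nonempty) (h𝒮M : ∀ S ∈ 𝒮, S ⊆ M)
    (htypes : ∀ S ∈ 𝒮, (ι S = 11 ∧ ι (M \ S) = 9) ∨ (ι S = 5 ∧ ι (M \ S) = 7)) :
    ∃ T ∈ goods (fun T : Finset (Sym2 (Fin n)) => ι (T ∩ M)), Odd #(𝒮.filter (fun S => S ⊆ T)) := by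
  classical
  -- the cell map `κ T = ι (T ∩ M)` is monotone
  set κ : Finset (Sym2 (Fin n)) → Fin 15 := fun T => ι (T ∩ M) with hκ
  have hmono : ∀ A B : Finset (Sym2 (Fin n)), A ⊆ B → ple (κ A) (κ B) = true := fun A B hAB =>
    ple_fibreMap a b c y C ι hι (Finset.inter_subset_inter hAB (subset_refl M))
  have hκS : ∀ S, S ⊆ M → κ S = ι S := fun S hS => by simp only [hκ, Finset.inter_eq_left.2 hS]
  have hκSc : ∀ S : Finset (Sym2 (Fin n)), κ Sᶜ = ι (M \ S) := fun S => by
    simp only [hκ]; congr 1; ext e; simp [Finset.mem_sdiff, Finset.mem_inter, and_comm]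
  -- marked points
  have hq0 : quad a b c y 0 = a := rfl
  have hq1 : quad a b c y 1 = b := rfl
  have hq2 : quad a b c y 2 = c := rfl
  have hq3 : quad a b c y 3 = y := rfl
  have hreach : ∀ (T : Finset (Sym2 (Fin n))) (i j : Fin 4),
      (openGraph (↑(C ∪ T) : Set (Sym2 (Fin n)))).Reachable (quad a b c y i) (quad a b c y j) ↔ pp (ι T) i j = true :=
    reachable_iff_pp a b c y C ι hι
  have hab_iff : ∀ T : Finset (Sym2 (Fin n)),
      (openGraph (↑(C ∪ T) : Set (Sym2 (Fin n)))).Reachable a b ↔ pp (ι T) 0 1 = true := fun T => by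
    have h := hreach T 0 1; rwa [hq0, hq1] at h
  have hac_iff : ∀ T : Finset (Sym2 (Fin n)),
      (openGraph (↑(C ∪ T) : Set (Sym2 (Fin n)))).Reachable a c ↔ pp (ι T) 0 2 = true := fun T => by
    have h := hreach T 0 2; rwa [hq0, hq2] at h
  have hcy_iff : ∀ T : Finset (Sym2 (Fin n)),
      (openGraph (↑(C ∪ T) : Set (Sym2 (Fin n)))).Reachable c y ↔ pp (ι T) 2 3 = true := fun T => by
    have h := hreach T 2 3; rwa [hq2, hq3] at h
  by_cases hX : ∃ S ∈ 𝒮, ι S = 11 ∧ ι (M \ S) = 9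
  · -- K1[ab|cy]-sides present: the handshake kernel
    obtain ⟨X₀, hX₀f, hX₀max⟩ := Finset.exists_max_image (𝒮.filter (fun S => ι S = 11 ∧ ι (M \ S) = 9)) Finset.card
      (by obtain ⟨S, hS, hS'⟩ := hX; exact ⟨S, Finset.mem_filter.2 ⟨hS, hS'⟩⟩)
    have hX₀ : X₀ ∈ 𝒮 := (Finset.mem_filter.1 hX₀f).1
    have hX₀t : ι X₀ = 11 ∧ ι (M \ X₀) = 9 := (Finset.mem_filter.1 hX₀f).2
    have hX₀M : X₀ ⊆ M := h𝒮M X₀ hX₀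
    -- the `ab`-component of `X₀`
    set A₀ : Finset (Sym2 (Fin n)) :=
      X₀.filter (fun e => ∀ v, v ∈ e → (openGraph (↑(C ∪ X₀) : Set (Sym2 (Fin n)))).Reachable a v) with hA₀
    have hA₀X₀ : A₀ ⊆ X₀ := Finset.filter_subset _ _
    have hA₀def : ∀ e ∈ X₀, (∀ v ∈ e, (openGraph (↑(C ∪ X₀) : Set (Sym2 (Fin n)))).Reachable a v) → e ∈ A₀ :=
      fun e he h => Finset.mem_filter.2 ⟨he, fun v hv => h v hv⟩
    have hA₀reach : ∀ e ∈ A₀, ∀ v ∈ e, (openGraph (↑(C ∪ A₀) : Set (Sym2 (Fin n)))).Reachable a v := by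
      intro e he v hv
      have h := (Finset.mem_filter.1 he).2 v hv
      exact reachable_ab_of_component C X₀ A₀ a v hA₀def h
    -- cells of `X₀`: a~b, c~y, a≁c in `C ∪ X₀`; c≁y in `C ∪ (M \ X₀)`
    have hab₀ : (openGraph (↑(C ∪ X₀) : Set (Sym2 (Fin n)))).Reachable a b :=
      (hab_iff X₀).2 (by rw [hX₀t.1]; decide)
    have hac₀ : ¬ (openGraph (↑(C ∪ X₀) : Set (Sym2 (Fin n)))).Reachable a c := by
      intro h; have h' := (hac_iff X₀).1 h; rw [hX₀t.1] at h'; exact absurd h' (by decide)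
    have habA : (openGraph (↑(C ∪ A₀) : Set (Sym2 (Fin n)))).Reachable a b :=
      reachable_ab_of_component C X₀ A₀ a b hA₀def hab₀
    -- no member other than `X₀` contains `X₀`
    have hmax : ∀ S ∈ 𝒮, X₀ ⊆ S → S = X₀ := by
      intro S hS hXS
      rcases htypes S hS with hK2 | hK4
      · exact Finset.eq_of_subset_of_card_le hXS (hX₀max S (Finset.mem_filter.2 ⟨hS, hK2⟩)) |>.symm
      · exfalso
        have h1 : ple (κ X₀) (κ S) = true := hmono X₀ S hXS
        rw [hκS X₀ hX₀M, hκS S (h𝒮M S hS), hX₀t.1, hK4.1] at h1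
        exact absurd h1 (by decide)
    -- a member containing `A₀` is a K1-side (it joins `a–b`)
    have hK2_of_A₀ : ∀ X ∈ 𝒮, A₀ ⊆ X → ι X = 11 ∧ ι (M \ X) = 9 := by
      intro X hXS hAX
      rcases htypes X hXS with h | h
      · exact h
      · exfalso
        have hab : (openGraph (↑(C ∪ X) : Set (Sym2 (Fin n)))).Reachable a b :=
          reachable_mono_finset (Finset.union_subset_union (subset_refl C) hAX) habA
        have hab' := (hab_iff X).1 hab
        rw [h.1] at hab'
        exact absurd hab' (by decide)
    -- the cells of the kernels `K = A₀ ∪ (X₀ \ X)`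
    have hcells : ∀ X ∈ 𝒮, A₀ ⊆ X → κ (A₀ ∪ (X₀ \ X)) = 6 ∧ κ (A₀ ∪ (X₀ \ X))ᶜ = 14 := by
      intro X hXS hAX
      have hXt := hK2_of_A₀ X hXS hAX
      have hXM : X ⊆ M := h𝒮M X hXS
      set K : Finset (Sym2 (Fin n)) := A₀ ∪ (X₀ \ X) with hK
      have hKX₀ : K ⊆ X₀ := Finset.union_subset hA₀X₀ Finset.sdiff_subset
      have hKM : K ⊆ M := hKX₀.trans hX₀M
      constructor
      · -- `κ K = ab|c|y`
        rw [hκS K hKM]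
        refine cell_eq_six_of (ι K) ?_ ?_ ?_
        · have h := hmono K X₀ hKX₀; rwa [hκS K hKM, hκS X₀ hX₀M, hX₀t.1] at h
        · have h : (openGraph (↑(C ∪ K) : Set (Sym2 (Fin n)))).Reachable a b :=
            reachable_mono_finset (Finset.union_subset_union (subset_refl C) Finset.subset_union_left) habA
          exact (hab_iff K).1 h
        · have h : ¬ (openGraph (↑(C ∪ K) : Set (Sym2 (Fin n)))).Reachable c y := by
            refine not_reachable_cy_of_kernel C X₀ K (X₀ \ X) a c y hKX₀ ?_ hac₀ ?_
            · intro e he hnot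
              rcases Finset.mem_union.1 he with heA | heD
              · exact absurd (Finset.mem_filter.1 heA).2 hnot
              · exact heD
            · intro hcy
              have h2 : (openGraph (↑(C ∪ (M \ X)) : Set (Sym2 (Fin n)))).Reachable c y :=
                reachable_mono_finset (Finset.union_subset_union (subset_refl C)
                  (Finset.sdiff_subset_sdiff hX₀M (subset_refl X))) hcy
              have h3 := (hcy_iff (M \ X)).1 h2
              rw [hXt.2] at h3
              exact absurd h3 (by decide)
          cases hpp : pp (ι K) 2 3
          · rfl
          · exact absurd ((hcy_iff K).2 hpp) h
      · -- `κ Kᶜ = abcy`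
        rw [hκSc K]
        refine cell_eq_fourteen_of_acby (ι (M \ K)) ?_ ?_
        · have h := hmono X₀ᶜ Kᶜ (Finset.compl_subset_compl.2 hKX₀)
          rwa [hκSc X₀, hκSc K, hX₀t.2] at h
        · have hcyX : (openGraph (↑(C ∪ X) : Set (Sym2 (Fin n)))).Reachable c y :=
            (hcy_iff X).2 (by rw [hXt.1]; decide)
          have hacX : ¬ (openGraph (↑(C ∪ X) : Set (Sym2 (Fin n)))).Reachable a c := by
            intro h; have h' := (hac_iff X).1 h; rw [hXt.1] at h'; exact absurd h' (by decide)
          have h1 := reachable_cy_avoid_component C X A₀ a c y hAX hA₀reach hcyX hacX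
          have hsub : X \ A₀ ⊆ M \ K := by
            intro e he
            rw [Finset.mem_sdiff] at he ⊢
            refine ⟨hXM he.1, ?_⟩
            intro heK
            rcases Finset.mem_union.1 heK with heA | heD
            · exact he.2 heA
            · exact (Finset.mem_sdiff.1 heD).2 he.1
          have h2 := reachable_mono_finset (Finset.union_subset_union (subset_refl C) hsub) h1
          exact (hcy_iff (M \ K)).1 h2
    -- the handshake kernel theorem
    refine exists_odd_good_of_handshake (goods κ) (goods_upper κ hmono) 𝒮 A₀ X₀ hX₀ hA₀X₀ hmax ?_
    intro X hXS hAX S hS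
    obtain ⟨h6, h14⟩ := hcells X hXS hAX
    refine union_compl_mem_goods_of_compatible κ hmono (subset_refl (A₀ ∪ (X₀ \ X))) ?_ ?_
    · rw [h14]
      rcases htypes S hS with h | h
      · rw [hκS S (h𝒮M S hS), h.1]; decide
      · rw [hκS S (h𝒮M S hS), h.1]; decide
    · rw [h6, hκSc S]
      rcases htypes S hS with h | h
      · rw [h.2]; decide
      · rw [h.2]; decide
  · -- only a→c lobes: a member of maximal size is a private compatible kernel
    have hall : ∀ S ∈ 𝒮, ι S = 5 ∧ ι (M \ S) = 7 := by
      intro S hS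
      rcases htypes S hS with h | h
      · exact absurd ⟨S, hS, h⟩ hX
      · exact h
    obtain ⟨W₀, hW₀, hW₀max⟩ := Finset.exists_max_image 𝒮 Finset.card hne
    have hW₀M : W₀ ⊆ M := h𝒮M W₀ hW₀
    refine exists_odd_good_of_subkernel κ hmono 𝒮 (subset_refl W₀) ?_ ?_
    · intro S hS
      rw [hκSc W₀, (hall W₀ hW₀).2, hκS W₀ hW₀M, (hall W₀ hW₀).1, hκS S (h𝒮M S hS), (hall S hS).1, hκSc S,
        (hall S hS).2]
      decide
    · have hEq : 𝒮.filter (fun S => W₀ ⊆ S) = {W₀} := by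
        ext S
        simp only [Finset.mem_filter, Finset.mem_singleton]
        constructor
        · rintro ⟨hS, hWS⟩
          exact (Finset.eq_of_subset_of_card_le hWS (hW₀max S hS)).symm
        · rintro rfl; exact ⟨hW₀, subset_refl _⟩
      rw [hEq, Finset.card_singleton]; exact odd_one

end TwoCopyMono

end Summit.CriticalPhenomena.PercolationContinuityZ3.Theorems
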